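import Literature.Analysis.FluidPDE.ConstantinFeffermanEnstrophySlab
import HarnessLib

/-!
# The enstrophy on a closed slab under a stretching bound with an integrable-in-time weight

search for candidate a priori estimates; no regularity claim (cell `pub-nsfunc`, literature seat:
a published Grönwall step as a THEOREM; nothing new).

The Grönwall step shared by the vorticity-based continuation criteria whose fixed-time stretching
estimate carries a time-dependent coefficient — Chae–Choe's two-vorticity-components criterion
(Electron. J. Differential Equations 1999 No. 05, proof of Thm. 1:
"`d/dt ‖ω(t)‖²₂ + ν‖∇ω(t)‖²₂ ≤ C ‖ω̃(t)‖_γ^{2γ/(2γ−3)} ‖ω(t)‖²₂`. Applying the standard Gronwall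
lemma, we have `‖ω(t)‖²₂ + ν∫₀ᵗ‖∇ω‖²₂ ≤ ‖ω₀‖²₂ exp(C∫₀ᵗ ‖ω̃(s)‖_γ^{2γ/(2γ−3)} ds)`"), Beirão da
Veiga–Berselli's Assumption A with `g ∈ L^a_t L^b_x`, Lemarié-Rieusset's Remark after Thm. 11.7:

* `integral_sq_norm_curl_le_mul_exp_of_weight_slab` — let `(u, p)` be a classical unforced
  Navier–Stokes solution on a closed slab `[0, T''] × ℝ³`, `ν > 0`, with all `L²` Sobolev
  seminorms bounded there, and suppose that at every time of the slab
  `2∫⟪ω, (∇u)ω⟫ ≤ ν ∫|∇ω|²_F + a(t) ∫|ω|²` with a weight `a ≥ 0` of lower integral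
  `∫₀^{T''} a ≤ A` (no measurability needed). Then `∫|ω(t)|² ≤ (∫|ω(0)|²) exp(A)` for all `t ∈ [0, T'']`.

The proof is the tree's `integral_sq_norm_curl_le_of_direction_slab` (Constantin–Fefferman's
slab bound, constant coefficients) with the coefficient made time dependent: the vorticity
equation on the slab, the `L²` balance `‖ω(b)‖² = ‖ω(0)‖² + ∫₀ᵇ 2∫⟪ω, ∂ₜω⟫`
(`IsSmoothSpaceTimeOn.l2_balance`), the vorticity energy identity
`∫⟪ω, ∂ₜω⟫ = −ν∫|∇ω|² + ∫⟪ω, (∇u)ω⟫` (`integral_inner_curl_eq_of_vorticity_eq`), and Grönwall's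
lemma in lower-integral form (`lintegral_gronwall_le`).

## Mathlib / tree search

Tree: `integral_sq_norm_curl_le_of_direction_slab`, `integral_inner_curl_eq_of_vorticity_eq`,
`norm_iteratedFDeriv_curl_le_opNorm_mul`, `exists_forall_norm_fderiv_fderiv_le_of_hasBoundedSobolevNormsOn`,
`lintegral_enorm_sq_le_of_norm_le_three` (`ConstantinFeffermanEnstrophySlab`),
`IsSmoothSpaceTimeOn.l2_balance` (`ClassicalL2Stability`), `lintegral_gronwall_le`
(`SerrinEnstrophyGronwall`), `linfty_bound_of_hasBoundedSobolevNormsOn_holds`,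
`exists_forall_norm_fderiv_le_of_hasBoundedSobolevNormsOn`, `lintegral_curl_sq_le`,
`IsClassicalNSSolutionOn.isVorticitySolutionOn_of_uniqueDiffOn`.

## References

* D. Chae, H.-J. Choe, *Regularity of solutions to the Navier–Stokes equation*, Electron. J.
  Differential Equations 1999 (1999), No. 05, 1–7: proof of Thm. 1, the Grönwall step (p. 4 of
  the paper; text read). [ChaeChoe1999]
* P. Constantin, C. Fefferman, Indiana Univ. Math. J. 42 (1993), §2 (the enstrophy bound; tree
  `integral_sq_norm_curl_le_of_direction_slab`). [ConstantinFeffermanIndiana1993]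
-/

noncomputable section

open MeasureTheory Set Function Filter Metric Real InnerProductSpace
open _root_.Topology
open scoped ENNReal NNReal RealInnerProductSpace ContDiff Laplacian

namespace Literature.Analysis.FluidPDE

-- nested operator types (second and third derivatives)
set_option maxSynthPendingDepth 3

/-- `ofReal (∫ f) ≤ ∫⁻ ofReal f` for every real function (junk value `0` if not integrable). [folklore] -/
private theorem ofReal_integral_le_lintegral_ofReal_w {α : Type*} [MeasurableSpace α] {μ : Measure α}
    (f : α → ℝ) : ENNReal.ofReal (∫ x, f x ∂μ) ≤ ∫⁻ x, ENNReal.ofReal (f x) ∂μ := by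
  by_cases hf : Integrable f μ
  · have hpos : Integrable (fun x => max (f x) 0) μ := hf.pos_part
    have h1 : ∫ x, f x ∂μ ≤ ∫ x, max (f x) 0 ∂μ := integral_mono hf hpos fun x => le_max_left _ _
    have h2 : ENNReal.ofReal (∫ x, max (f x) 0 ∂μ) = ∫⁻ x, ENNReal.ofReal (max (f x) 0) ∂μ :=
      ofReal_integral_eq_lintegral_ofReal hpos (Eventually.of_forall fun x => le_max_right _ _)
    have h3 : ∫⁻ x, ENNReal.ofReal (max (f x) 0) ∂μ = ∫⁻ x, ENNReal.ofReal (f x) ∂μ := by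
      refine lintegral_congr fun x => ?_
      rcases le_total (f x) 0 with h | h
      · rw [max_eq_right h, ENNReal.ofReal_of_nonpos h, ENNReal.ofReal_zero]
      · rw [max_eq_left h]
    calc ENNReal.ofReal (∫ x, f x ∂μ) ≤ ENNReal.ofReal (∫ x, max (f x) 0 ∂μ) := ENNReal.ofReal_le_ofReal h1
      _ = ∫⁻ x, ENNReal.ofReal (f x) ∂μ := by rw [h2, h3]
  · rw [integral_undef hf, ENNReal.ofReal_zero]
    exact zero_le

set_option maxHeartbeats 1600000 in
/-- **The enstrophy bound on a closed slab under a stretching estimate with an integrable weight**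
(the Grönwall step of Chae–Choe 1999, proof of Thm. 1: "`d/dt‖ω‖²₂ + ν‖∇ω‖²₂ ≤ C‖ω̃‖_γ^{2γ/(2γ−3)}‖ω‖²₂`
… applying the standard Gronwall lemma … `≤ ‖ω₀‖²₂ exp(C∫₀ᵗ‖ω̃(s)‖_γ^{2γ/(2γ−3)}ds)`"; the
time-dependent twin of the tree's `integral_sq_norm_curl_le_of_direction_slab`). Let `(u, p)` be a
classical unforced Navier–Stokes solution on the closed slab `[0, T''] × ℝ³`, `ν > 0`, with all
`L²` Sobolev seminorms bounded there. Let `a ≥ 0` be a weight with `∫₀^{T''} a ≤ A` (lower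
integral; no measurability is needed), such that at every `t ∈ [0, T'']`
`2∫⟪ω, (∇u)ω⟫ ≤ ν ∫|∇ω|²_F + a(t) ∫|ω|²` (`ω = curl u(t)`). Then
`∫|ω(t)|² ≤ (∫|ω(0)|²) · exp A` for all `t ∈ [0, T'']`. [cite: ChaeChoe1999, proof of Thm. 1 (the Grönwall step, p. 4); ConstantinFeffermanIndiana1993, §2 (the enstrophy bound)] -/
theorem integral_sq_norm_curl_le_mul_exp_of_weight_slab {ν T'' : ℝ} (hν : 0 < ν) (hT'' : 0 < T'')
    {u : ℝ → (EuclideanSpace ℝ (Fin 3)) → (EuclideanSpace ℝ (Fin 3))} {p : ℝ → (EuclideanSpace ℝ (Fin 3)) → ℝ}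
    (hS : IsClassicalNSSolutionOn (Icc 0 T'') ν 0 u p)
    (hB : HasBoundedSobolevNormsOn (Icc 0 T'') u)
    {a : ℝ → ℝ} (ha0 : ∀ t, 0 ≤ a t)
    {A : ℝ} (hA0 : 0 ≤ A) (hA : ∫⁻ t in Ioo 0 T'', ENNReal.ofReal (a t) ≤ ENNReal.ofReal A)
    (hstr : ∀ t ∈ Icc 0 T'',
      2 * ∫ x, ⟪curl (u t) x, fderiv ℝ (u t) x (curl (u t) x)⟫ ≤
        ν * (∫ x, frobeniusNormSq (fderiv ℝ (curl (u t)) x)) + a t * (∫ x, ‖curl (u t) x‖ ^ 2)) :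
    ∀ t ∈ Icc 0 T'', ∫ x, ‖curl (u t) x‖ ^ 2 ≤ (∫ x, ‖curl (u 0) x‖ ^ 2) * Real.exp A := by
  have hU : UniqueDiffOn ℝ (Icc 0 T'') := uniqueDiffOn_Icc hT''
  have h0S : (0 : ℝ) ∈ Icc 0 T'' := ⟨le_rfl, hT''.le⟩
  set κ : ℝ := ‖curlCLM‖ with hκ
  -- smoothness of the slices
  have hsm : ∀ t ∈ Icc 0 T'', ContDiff ℝ ∞ (u t) := fun t ht => hS.contDiff_velocity ht
  have hsm4 : ∀ t ∈ Icc 0 T'', ContDiff ℝ 4 (u t) := fun t ht => (hsm t ht).of_le (by norm_cast)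
  have hsm3 : ∀ t ∈ Icc 0 T'', ContDiff ℝ 3 (u t) := fun t ht => (hsm t ht).of_le (by norm_cast)
  have hsm2 : ∀ t ∈ Icc 0 T'', ContDiff ℝ 2 (u t) := fun t ht => (hsm t ht).of_le (by norm_cast)
  -- sup bounds
  obtain ⟨B₀, hB₀⟩ := linfty_bound_of_hasBoundedSobolevNormsOn_holds hsm2 hB
  obtain ⟨B₁, hB₁0, hB₁⟩ := exists_forall_norm_fderiv_le_of_hasBoundedSobolevNormsOn hsm3 hB
  obtain ⟨B₂, hB₂0, hB₂⟩ := exists_forall_norm_fderiv_fderiv_le_of_hasBoundedSobolevNormsOn hsm4 hB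
  have hB₀0 : 0 ≤ B₀ := (norm_nonneg _).trans (hB₀ 0 h0S 0)
  -- the Sobolev bounds
  have hfin : ∀ n, ∀ t ∈ Icc 0 T'', ∫⁻ x, ‖iteratedFDeriv ℝ n (u t) x‖ₑ ^ 2 < ⊤ := fun n t ht => by
    obtain ⟨C, hC⟩ := hB n
    exact (hC t ht).trans_lt ENNReal.coe_lt_top
  choose Cn hCn using hB
  -- the vorticity field and its time derivative
  set vort : ℝ → (EuclideanSpace ℝ (Fin 3)) → (EuclideanSpace ℝ (Fin 3)) := vorticity u with hωdef
  have hωt : ∀ t, vort t = curl (u t) := fun t => rfl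
  have hωsm : IsSmoothSpaceTimeOn (Icc 0 T'') vort :=
    (hS.smooth_velocity.fderiv_slice hU).clm_comp curlCLM
  set W : ℝ → (EuclideanSpace ℝ (Fin 3)) → (EuclideanSpace ℝ (Fin 3)) := timeDerivWithin (Icc 0 T'') vort with hWdef
  have hWsm : IsSmoothSpaceTimeOn (Icc 0 T'') W := hωsm.timeDerivWithin hU
  have hvort : ∀ t ∈ Icc 0 T'', ∀ x,
      W t x + convect (u t) (vort t) x = convect (vort t) (u t) x + ν • (Δ (vort t)) x := fun t ht x =>
    (hS.isVorticitySolutionOn_of_uniqueDiffOn hU (fun s _ y => curl_zero y)).vorticity_eq t ht x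
  -- `L²` bound for the vorticity
  set V₀ : ℝ≥0∞ := ENNReal.ofReal (κ ^ 2) * (Cn 1 : ℝ≥0∞) with hV₀
  have hV₀top : V₀ < ⊤ := ENNReal.mul_lt_top ENNReal.ofReal_lt_top ENNReal.coe_lt_top
  have hωL2 : ∀ t ∈ Icc 0 T'', ∫⁻ x, ‖vort t x‖ₑ ^ 2 ≤ V₀ := fun t ht =>
    (lintegral_curl_sq_le (u t)).trans (mul_le_mul' le_rfl (hCn 1 t ht))
  -- `L²` bound for the time derivative of the vorticity
  set V₁ : ℝ≥0∞ := 3 * (ENNReal.ofReal ((ν * (3 * κ)) ^ 2) * (Cn 3 : ℝ≥0∞) +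
    ENNReal.ofReal ((B₀ * κ) ^ 2) * (Cn 2 : ℝ≥0∞) + ENNReal.ofReal ((B₁ * κ) ^ 2) * (Cn 1 : ℝ≥0∞))
    with hV₁
  have hV₁top : V₁ < ⊤ := by
    refine ENNReal.mul_lt_top (by norm_num) ?_
    refine ENNReal.add_lt_top.2 ⟨ENNReal.add_lt_top.2 ⟨?_, ?_⟩, ?_⟩ <;>
      exact ENNReal.mul_lt_top ENNReal.ofReal_lt_top ENNReal.coe_lt_top
  have hWL2 : ∀ t ∈ Icc 0 T'', ∫⁻ x, ‖W t x‖ₑ ^ 2 ≤ V₁ := by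
    intro t ht
    have hv := hsm3 t ht
    have hpt : ∀ x, ‖W t x‖ ≤ (ν * (3 * κ)) * ‖iteratedFDeriv ℝ 3 (u t) x‖ +
        (B₀ * κ) * ‖iteratedFDeriv ℝ 2 (u t) x‖ + (B₁ * κ) * ‖iteratedFDeriv ℝ 1 (u t) x‖ := by
      intro x
      have hw2 : ContDiff ℝ 2 (curl (u t)) := contDiff_curl (n := 2) (by exact hv)
      have heq : W t x = ν • (Δ (vort t)) x - convect (u t) (vort t) x + convect (vort t) (u t) x := by
        have h := hvort t ht x
        have : W t x = convect (vort t) (u t) x + ν • (Δ (vort t)) x - convect (u t) (vort t) x :=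
          eq_sub_of_add_eq h
        rw [this]; abel
      rw [heq, hωt]
      have t1 : ‖ν • (Δ (curl (u t))) x‖ ≤ (ν * (3 * κ)) * ‖iteratedFDeriv ℝ 3 (u t) x‖ := by
        rw [norm_smul, Real.norm_of_nonneg hν.le, mul_assoc, mul_assoc]
        refine mul_le_mul_of_nonneg_left ?_ hν.le
        calc ‖(Δ (curl (u t))) x‖ ≤ 3 * ‖iteratedFDeriv ℝ 2 (curl (u t)) x‖ :=
              norm_laplacian_le_three_mul_norm_iteratedFDeriv_two hw2 x
          _ ≤ 3 * (κ * ‖iteratedFDeriv ℝ 3 (u t) x‖) :=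
              mul_le_mul_of_nonneg_left (norm_iteratedFDeriv_curl_le_opNorm_mul hv 2 (by norm_num) x) (by norm_num)
      have t2 : ‖convect (u t) (curl (u t)) x‖ ≤ (B₀ * κ) * ‖iteratedFDeriv ℝ 2 (u t) x‖ := by
        rw [convect]
        calc ‖fderiv ℝ (curl (u t)) x (u t x)‖ ≤ ‖fderiv ℝ (curl (u t)) x‖ * ‖u t x‖ :=
              ContinuousLinearMap.le_opNorm _ _
          _ ≤ (κ * ‖iteratedFDeriv ℝ 2 (u t) x‖) * B₀ := by
              refine mul_le_mul ?_ (hB₀ t ht x) (norm_nonneg _) (by positivity)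
              rw [← norm_iteratedFDeriv_one]
              exact norm_iteratedFDeriv_curl_le_opNorm_mul hv 1 (by norm_num) x
          _ = (B₀ * κ) * ‖iteratedFDeriv ℝ 2 (u t) x‖ := by ring
      have t3 : ‖convect (curl (u t)) (u t) x‖ ≤ (B₁ * κ) * ‖iteratedFDeriv ℝ 1 (u t) x‖ := by
        rw [convect]
        calc ‖fderiv ℝ (u t) x (curl (u t) x)‖ ≤ ‖fderiv ℝ (u t) x‖ * ‖curl (u t) x‖ :=
              ContinuousLinearMap.le_opNorm _ _
          _ ≤ B₁ * (κ * ‖iteratedFDeriv ℝ 1 (u t) x‖) := by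
              refine mul_le_mul (hB₁ t ht x) ?_ (norm_nonneg _) hB₁0
              have h := norm_iteratedFDeriv_curl_le_opNorm_mul hv 0 (by norm_num) x
              rwa [norm_iteratedFDeriv_zero] at h
          _ = (B₁ * κ) * ‖iteratedFDeriv ℝ 1 (u t) x‖ := by ring
      have e1 : ‖ν • (Δ (curl (u t))) x - convect (u t) (curl (u t)) x + convect (curl (u t)) (u t) x‖ ≤
          ‖ν • (Δ (curl (u t))) x - convect (u t) (curl (u t)) x‖ + ‖convect (curl (u t)) (u t) x‖ :=
        norm_add_le _ _
      have e2 : ‖ν • (Δ (curl (u t))) x - convect (u t) (curl (u t)) x‖ ≤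
          ‖ν • (Δ (curl (u t))) x‖ + ‖convect (u t) (curl (u t)) x‖ := norm_sub_le _ _
      linarith [e1, e2, t1, t2, t3]
    refine (lintegral_enorm_sq_le_of_norm_le_three ((hv.continuous_iteratedFDeriv le_rfl))
      (hv.continuous_iteratedFDeriv (by norm_num)) (hv.continuous_iteratedFDeriv (by norm_num))
      (by positivity) (by positivity) (by positivity) hpt).trans ?_
    rw [hV₁]
    exact mul_le_mul' le_rfl (add_le_add (add_le_add (mul_le_mul' le_rfl (hCn 3 t ht))
      (mul_le_mul' le_rfl (hCn 2 t ht))) (mul_le_mul' le_rfl (hCn 1 t ht)))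
  -- the balance of the enstrophy
  obtain ⟨-, hYcont, hbal⟩ := hωsm.l2_balance hT'' (C₀ := V₀.toNNReal) (C₁ := V₁.toNNReal)
    (fun t ht => by rw [ENNReal.coe_toNNReal hV₀top.ne]; exact hωL2 t ht)
    (fun t ht => by rw [ENNReal.coe_toNNReal hV₁top.ne]; exact hWL2 t ht)
  -- the quantities
  set Y : ℝ → ℝ := fun t => ∫ x, ‖vort t x‖ ^ 2 with hYdef
  set Φ : ℝ → ℝ := fun t => ∫ x, 2 * ⟪vort t x, W t x⟫ with hΦdef
  have hY0 : ∀ t, 0 ≤ Y t := fun t => integral_nonneg fun x => sq_nonneg _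
  have hYV : ∀ t ∈ Icc 0 T'', ENNReal.ofReal (Y t) ≤ V₀ := by
    intro t ht
    have hi : Integrable fun x => ‖vort t x‖ ^ 2 := by
      refine integrable_sq_norm_of_lintegral_lt_top (hωsm.contDiff_slice ht).continuous ?_
      exact (hωL2 t ht).trans_lt hV₀top
    rw [hYdef]
    show ENNReal.ofReal (∫ x, ‖vort t x‖ ^ 2) ≤ V₀
    rw [ofReal_integral_eq_lintegral_ofReal hi (Eventually.of_forall fun x => sq_nonneg _)]
    refine le_trans (le_of_eq (lintegral_congr fun x => ?_)) (hωL2 t ht)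
    rw [← ofReal_norm, ENNReal.ofReal_pow (norm_nonneg _)]
  -- the slice inequality `Φ t ≤ a t * Y t`
  have hslice : ∀ t ∈ Icc 0 T'', Φ t ≤ a t * Y t := by
    intro t ht
    have hv := hsm3 t ht
    have hid := integral_inner_curl_eq_of_vorticity_eq hv (hS.divFree t ht) (hvort t ht)
      (hB₀ t ht) (hB₁ t ht) (hfin 1 t ht) (hfin 2 t ht) (hfin 3 t ht)
    have hst := hstr t ht
    have hDnn : 0 ≤ ∫ x, frobeniusNormSq (fderiv ℝ (curl (u t)) x) :=
      integral_nonneg fun x => frobeniusNormSq_nonneg _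
    have hΦt : Φ t = 2 * ∫ x, ⟪vort t x, W t x⟫ := by
      rw [hΦdef]
      exact integral_const_mul _ _
    rw [hΦt, hωt, hid]
    have hYt : Y t = ∫ x, ‖curl (u t) x‖ ^ 2 := rfl
    rw [hYt]
    nlinarith [hst, hν, hDnn, ha0 t]
  -- Grönwall, lower-integral form
  set φ : ℝ → ℝ≥0∞ := fun t => ENNReal.ofReal (Y t) with hφdef
  set aE : ℝ → ℝ≥0∞ := fun t => ENNReal.ofReal (a t) with haEdef
  set Bg : ℝ≥0∞ := ENNReal.ofReal (Y 0) with hBg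
  have hineq : ∀ b ∈ Icc 0 T'', φ b ≤ Bg + ∫⁻ s in Ioo 0 b, aE s * φ s := by
    intro b hb
    rcases eq_or_lt_of_le hb.1 with h0 | hb0
    · rw [← h0]
      simp only [Ioo_self, Measure.restrict_empty, lintegral_zero_measure, add_zero]
      rw [hφdef, hBg]
    have hbalb := hbal b ⟨hb0, hb.2⟩
    -- `Y b = Y 0 + ∫₀ᵇ Φ`
    have hYb : Y b = Y 0 + ∫ t in Ioo 0 b, Φ t := by
      have h : (∫ x, ‖vort b x‖ ^ 2) = (∫ x, ‖vort 0 x‖ ^ 2) + ∫ t in (0 : ℝ)..b, Φ t := hbalb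
      rw [intervalIntegral.integral_of_le hb0.le, integral_Ioc_eq_integral_Ioo] at h
      exact h
    -- pointwise bound on `(0, b)`
    have hpt : ∀ t ∈ Ioo 0 b, ENNReal.ofReal (Φ t) ≤ aE t * φ t := by
      intro t ht
      have htS : t ∈ Icc 0 T'' := ⟨ht.1.le, ht.2.le.trans hb.2⟩
      rw [haEdef, hφdef, ← ENNReal.ofReal_mul (ha0 t)]
      exact ENNReal.ofReal_le_ofReal (hslice t htS)
    calc φ b = ENNReal.ofReal (Y 0 + ∫ t in Ioo 0 b, Φ t) := by
          show ENNReal.ofReal (Y b) = _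
          rw [hYb]
      _ ≤ ENNReal.ofReal (Y 0) + ENNReal.ofReal (∫ t in Ioo 0 b, Φ t) := ENNReal.ofReal_add_le
      _ ≤ ENNReal.ofReal (Y 0) + ∫⁻ t in Ioo 0 b, ENNReal.ofReal (Φ t) :=
          add_le_add le_rfl (ofReal_integral_le_lintegral_ofReal_w _)
      _ ≤ ENNReal.ofReal (Y 0) + ∫⁻ t in Ioo 0 b, aE t * φ t :=
          add_le_add le_rfl (setLIntegral_mono' measurableSet_Ioo hpt)
      _ = Bg + ∫⁻ s in Ioo 0 b, aE s * φ s := by rw [hBg]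
  -- hypotheses of Grönwall
  have hBgtop : Bg ≠ ⊤ := ENNReal.ofReal_ne_top
  have hφM : ∀ t ∈ Icc 0 T'', φ t ≤ V₀ := fun t ht => hYV t ht
  have hatop : ∫⁻ t in Ioo 0 T'', aE t ≠ ⊤ :=
    ne_top_of_le_ne_top ENNReal.ofReal_ne_top hA
  have hgron := lintegral_gronwall_le hBgtop hV₀top.ne hφM hatop hineq
  -- the exponent
  have hexp : ∀ t ∈ Icc 0 T'', (∫⁻ s in Ioo 0 t, aE s).toReal ≤ A := by
    intro t ht
    have h1 : ∫⁻ s in Ioo 0 t, aE s ≤ ∫⁻ s in Ioo 0 T'', aE s :=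
      lintegral_mono_set (Ioo_subset_Ioo le_rfl ht.2)
    have h4 := h1.trans hA
    have := ENNReal.toReal_mono ENNReal.ofReal_ne_top h4
    rwa [ENNReal.toReal_ofReal hA0] at this
  -- conclusion
  intro t ht
  have hg := hgron t ht
  have hfinal : φ t ≤ ENNReal.ofReal ((∫ x, ‖curl (u 0) x‖ ^ 2) * Real.exp A) := by
    refine hg.trans ?_
    rw [hBg, ← ENNReal.ofReal_mul (hY0 0)]
    refine ENNReal.ofReal_le_ofReal (mul_le_mul_of_nonneg_left ?_ (hY0 0))
    exact Real.exp_le_exp.2 (hexp t ht)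
  have := (ENNReal.ofReal_le_ofReal_iff (by positivity)).1 hfinal
  exact this

/-- **The same slab bound with the stretching estimate only at almost every time** (the form
needed by criteria whose weight is finite only for a.e. `t`, e.g. Chae–Choe's
`‖ω̃(t)‖_γ^{2γ/(2γ−3)}` under `ω̃ ∈ L^α(0,T;L^γ)`): if
`2∫⟪ω, (∇u)ω⟫ ≤ ν ∫|∇ω|²_F + a(t) ∫|ω|²` holds for a.e. `t ∈ (0, T'')` with `a ≥ 0`,
`∫₀^{T''} a ≤ A`, then `∫|ω(t)|² ≤ (∫|ω(0)|²) exp A` on `[0, T'']`. Reduced to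
`integral_sq_norm_curl_le_mul_exp_of_weight_slab` by modifying the weight on the exceptional null
set of times (there `2∫⟪ω, (∇u)ω⟫ ≤ 2 sup|∇u| ∫|ω|²`, so the weight `a + 2 sup|∇u|` works), which
does not change its lower integral. [cite: ChaeChoe1999, proof of Thm. 1 (the Grönwall step, p. 4)] -/
theorem integral_sq_norm_curl_le_mul_exp_of_weight_slab_ae {ν T'' : ℝ} (hν : 0 < ν) (hT'' : 0 < T'')
    {u : ℝ → (EuclideanSpace ℝ (Fin 3)) → (EuclideanSpace ℝ (Fin 3))} {p : ℝ → (EuclideanSpace ℝ (Fin 3)) → ℝ}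
    (hS : IsClassicalNSSolutionOn (Icc 0 T'') ν 0 u p)
    (hB : HasBoundedSobolevNormsOn (Icc 0 T'') u)
    {a : ℝ → ℝ} (ha0 : ∀ t, 0 ≤ a t)
    {A : ℝ} (hA0 : 0 ≤ A) (hA : ∫⁻ t in Ioo 0 T'', ENNReal.ofReal (a t) ≤ ENNReal.ofReal A)
    (hstr : ∀ᵐ t ∂(volume.restrict (Ioo 0 T'')),
      2 * ∫ x, ⟪curl (u t) x, fderiv ℝ (u t) x (curl (u t) x)⟫ ≤
        ν * (∫ x, frobeniusNormSq (fderiv ℝ (curl (u t)) x)) + a t * (∫ x, ‖curl (u t) x‖ ^ 2)) :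
    ∀ t ∈ Icc 0 T'', ∫ x, ‖curl (u t) x‖ ^ 2 ≤ (∫ x, ‖curl (u 0) x‖ ^ 2) * Real.exp A := by
  classical
  -- smoothness and the sup bound of `∇u` on the slab
  have hsm : ∀ t ∈ Icc 0 T'', ContDiff ℝ ∞ (u t) := fun t ht => hS.contDiff_velocity ht
  have hsm3 : ∀ t ∈ Icc 0 T'', ContDiff ℝ 3 (u t) := fun t ht => (hsm t ht).of_le (by norm_cast)
  obtain ⟨B₁, hB₁0, hB₁⟩ := exists_forall_norm_fderiv_le_of_hasBoundedSobolevNormsOn hsm3 hB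
  -- the stretching is crudely bounded by `B₁ ∫|ω|²` at every time of the slab
  have hcrude : ∀ t ∈ Icc 0 T'', 2 * ∫ x, ⟪curl (u t) x, fderiv ℝ (u t) x (curl (u t) x)⟫ ≤
      2 * B₁ * ∫ x, ‖curl (u t) x‖ ^ 2 := by
    intro t ht
    have hv := hsm t ht
    have hfin1 : ∫⁻ x, ‖iteratedFDeriv ℝ 1 (u t) x‖ₑ ^ 2 < ⊤ := by
      obtain ⟨C1, hC1⟩ := hB 1
      exact (hC1 t ht).trans_lt ENNReal.coe_lt_top
    have hωc : Continuous (curl (u t)) := continuous_curl (hv.of_le (by norm_cast))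
    have hi : Integrable fun x => ‖curl (u t) x‖ ^ 2 := by
      refine integrable_sq_norm_of_lintegral_lt_top hωc ?_
      exact lt_of_le_of_lt (lintegral_curl_sq_le (u t)) (ENNReal.mul_lt_top ENNReal.ofReal_lt_top hfin1)
    have hpt : ∀ x, ⟪curl (u t) x, fderiv ℝ (u t) x (curl (u t) x)⟫ ≤ B₁ * ‖curl (u t) x‖ ^ 2 := by
      intro x
      calc ⟪curl (u t) x, fderiv ℝ (u t) x (curl (u t) x)⟫
          ≤ ‖curl (u t) x‖ * ‖fderiv ℝ (u t) x (curl (u t) x)‖ := real_inner_le_norm _ _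
        _ ≤ ‖curl (u t) x‖ * (B₁ * ‖curl (u t) x‖) := by
            refine mul_le_mul_of_nonneg_left ?_ (norm_nonneg _)
            exact ((fderiv ℝ (u t) x).le_opNorm _).trans
              (mul_le_mul_of_nonneg_right (hB₁ t ht x) (norm_nonneg _))
        _ = B₁ * ‖curl (u t) x‖ ^ 2 := by ring
    have hle : ∫ x, ⟪curl (u t) x, fderiv ℝ (u t) x (curl (u t) x)⟫ ≤ ∫ x, B₁ * ‖curl (u t) x‖ ^ 2 := by
      by_cases hI : Integrable (fun x => ⟪curl (u t) x, fderiv ℝ (u t) x (curl (u t) x)⟫) volume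
      · exact integral_mono hI (hi.const_mul _) hpt
      · rw [integral_undef hI]
        exact integral_nonneg fun x => mul_nonneg hB₁0 (sq_nonneg _)
    rw [integral_const_mul] at hle
    linarith
  -- the modified weight
  set P : ℝ → Prop := fun t =>
    2 * ∫ x, ⟪curl (u t) x, fderiv ℝ (u t) x (curl (u t) x)⟫ ≤
      ν * (∫ x, frobeniusNormSq (fderiv ℝ (curl (u t)) x)) + a t * (∫ x, ‖curl (u t) x‖ ^ 2) with hP
  set a' : ℝ → ℝ := fun t => if P t then a t else a t + 2 * B₁ with ha'
  have ha'0 : ∀ t, 0 ≤ a' t := fun t => by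
    rw [ha']; dsimp only
    split_ifs
    · exact ha0 t
    · linarith [ha0 t]
  have ha'eq : ∀ᵐ t ∂(volume.restrict (Ioo 0 T'')), a' t = a t := by
    filter_upwards [hstr] with t ht
    rw [ha']; dsimp only
    rw [if_pos ht]
  have hA' : ∫⁻ t in Ioo 0 T'', ENNReal.ofReal (a' t) ≤ ENNReal.ofReal A := by
    refine le_trans (le_of_eq (lintegral_congr_ae ?_)) hA
    filter_upwards [ha'eq] with t ht
    rw [ht]
  have hstr' : ∀ t ∈ Icc 0 T'',
      2 * ∫ x, ⟪curl (u t) x, fderiv ℝ (u t) x (curl (u t) x)⟫ ≤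
        ν * (∫ x, frobeniusNormSq (fderiv ℝ (curl (u t)) x)) + a' t * (∫ x, ‖curl (u t) x‖ ^ 2) := by
    intro t ht
    rw [ha']; dsimp only
    by_cases hPt : P t
    · rw [if_pos hPt]; exact hPt
    · rw [if_neg hPt]
      have hD : 0 ≤ ν * ∫ x, frobeniusNormSq (fderiv ℝ (curl (u t)) x) :=
        mul_nonneg hν.le (integral_nonneg fun x => frobeniusNormSq_nonneg _)
      have hY : 0 ≤ ∫ x, ‖curl (u t) x‖ ^ 2 := integral_nonneg fun x => sq_nonneg _
      nlinarith [hcrude t ht, ha0 t, hD, hY]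
  exact integral_sq_norm_curl_le_mul_exp_of_weight_slab hν hT'' hS hB ha'0 hA0 hA' hstr'

end Literature.Analysis.FluidPDE

end
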